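import Summits.KontsevichZagierPeriods.KontsevichZagierPeriods.Theorems.HurwitzMicroSectorsNormalFormPrincipleAngCarriers
import Summits.KontsevichZagierPeriods.KontsevichZagierPeriods.Theorems.AbelContractionRealHyperellipticSectorPortDlogMoves
import Summits.KontsevichZagierPeriods.KontsevichZagierPeriods.Theorems.AbelContractionRealHyperellipticSectorPortSiegeNfAPoleOneK3

/-!
# Route AbelContraction — `RealHyperellipticSector` (crux stmt-KontsevichZagierPeriods-12475):
# the dimension-certified port, layer 3 — the arctangent representations and carriers `T(t, d)`

Helper file of the line `Lines/birth.lean` (stub `stub_bakerAlg`, `--supports` the crux): the port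
of `Theorems/HurwitzMicroSectorsNormalFormPrincipleAngCarriers.lean` (namespace
`…NormalFormPrinciple.PiBox.Dlog`) INTO THE BUDGET `KZ.relationsLE 1`: the arctangent
representations `[(a,b), d/(1+y²)]` with real algebraic data (zero constant, reflection `y ↦ −y`
as ONE rule-(2) move in dimension `1`), a fixed family of arctangent carriers
`RG t d = [(0,t), d/(1+y²)]`, additivity and `ℤ`-linearity in `d` in `FormalRep ⧸ relationsLE 1`,
and `ang_interval_eq` (registered sub-goal): every arctangent interval is a sum of two carriers
with `tᵢ ≥ 0` modulo `relationsLE 1`. Also the generic one-domain moves `merge_mem_relationsLE`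
(rule 1b) and `congr_mem_relationsLE` in dimension `1`. Every move is among representations of
dimension `1`.

The dimension-free lemmas of the original (`exists_angA`, `value_angA`, `exists_angCarrier`) are
reused by importing it; names and hypotheses are those of the original with
`relations ↦ relationsLE` (`relationsLE 1` in the quotients).

Sources: M. Kontsevich, D. Zagier, *Periods* (2001), §1.2 rules (1), (2) [KontsevichZagier2001].
No definitions are introduced.
-/

noncomputable section

open MeasureTheory Set
open Literature.NumberTheory.Transcendental Literature.NumberTheory.Transcendental.KZ
open Literature.ModelTheory.ExponentialFields (IsSemialgebraic)
open Summit.KontsevichZagierPeriods.AbelContraction.AbelContractionLemma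
  (mem_relationsLE_of_integrandAdd of_mem_relationsLE_of_eqOn_zero)

namespace Summit.KontsevichZagierPeriods.AbelContraction.RealHyperellipticSector.Port

namespace Dlog

open Summit.KontsevichZagierPeriods.HurwitzMicroSectors.NormalFormPrinciple.PiBox.Dlog (exists_angA)

/-! ## General one-domain moves inside the budget -/

/-- **Merging on one domain** (rule 1b among representations of dimension `1`) (inside the budget
`relationsLE 1`): representations `L, L₁, L₂` on one domain `σ` with integrands `f₁ + f₂`, `f₁`,
`f₂` (on `σ`) give `[L] − [L₁] − [L₂] ∈ relationsLE 1`. [cite: KontsevichZagier2001, §1.2 rule (1)] -/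
theorem merge_mem_relationsLE {σ : Set (Fin 1 → ℝ)} {f₁ f₂ : (Fin 1 → ℝ) → ℝ}
    (L L₁ L₂ : IntegralRep 1) (hd : L.domain = σ) (hd₁ : L₁.domain = σ) (hd₂ : L₂.domain = σ)
    (hi : EqOn L.integrand (f₁ + f₂) L.domain) (hi₁ : EqOn L₁.integrand f₁ L₁.domain)
    (hi₂ : EqOn L₂.integrand f₂ L₂.domain) : of L - of L₁ - of L₂ ∈ relationsLE 1 := by
  refine mem_relationsLE_of_integrandAdd le_rfl (hd₁.trans hd.symm) (hd₂.trans hd.symm)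
    fun x hx => ?_
  rw [Pi.add_apply, hi hx, hi₁ (by rw [hd₁, ← hd]; exact hx), hi₂ (by rw [hd₂, ← hd]; exact hx)]
  rfl

/-- Congruence on one domain (inside the budget `relationsLE 1`).
[cite: KontsevichZagier2001, §1.2 rule (1)] -/
theorem congr_mem_relationsLE {σ : Set (Fin 1 → ℝ)} {f : (Fin 1 → ℝ) → ℝ} (L L' : IntegralRep 1)
    (hd : L.domain = σ) (hd' : L'.domain = σ) (hi : EqOn L.integrand f L.domain)
    (hi' : EqOn L'.integrand f L'.domain) : of L - of L' ∈ relationsLE 1 :=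
  Budget.congr_mem_relationsLE le_rfl (hd'.trans hd.symm) fun x hx => by
    rw [hi hx, hi' (by rw [hd', ← hd]; exact hx)]

/-! ## The arctangent representations inside the budget -/

/-- Zero constant: `[(a,b), 0/(1+y²)] ∈ relationsLE 1` (inside the budget `relationsLE 1`).
[cite: KontsevichZagier2001, §1.2] -/
theorem angA_zero_mem_relationsLE (L : IntegralRep 1)
    (hi : EqOn L.integrand (fun x => (0:ℝ) / (1 + x 0 ^ 2)) L.domain) : of L ∈ relationsLE 1 :=
  of_mem_relationsLE_of_eqOn_zero le_rfl L fun x hx => by simp [hi hx]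

/-- **Reflection** (rule 2 among representations of dimension `1`) (inside the budget
`relationsLE 1`): `[(a,b), d/(1+y²)] − [(−b,−a), d/(1+y²)] ∈ relationsLE 1` (`y ↦ −y`).
[cite: KontsevichZagier2001, §1.2 rule (2)] -/
theorem angA_reflect_mem_relationsLE {a b d : ℝ} (L L' : IntegralRep 1)
    (hdL : L.domain = {x | x 0 ∈ Set.Ioo a b}) (hdL' : L'.domain = {x | x 0 ∈ Set.Ioo (-b) (-a)})
    (hi : EqOn L.integrand (fun x => d / (1 + x 0 ^ 2)) L.domain)
    (hi' : EqOn L'.integrand (fun x => d / (1 + x 0 ^ 2)) L'.domain) :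
    of L - of L' ∈ relationsLE 1 := by
  refine SiegeK3.affineA_sub_mem_relationsLE (s := -1) (t := 0) isAlgebraic_one.neg
    isAlgebraic_zero (by norm_num) L L' (fun y => d / (1 + y ^ 2)) ?_ hi' fun x hx => ?_
  · rw [hdL, hdL']
    ext y
    simp only [Set.mem_setOf_eq, Set.mem_image, Set.mem_Ioo]
    constructor
    · rintro ⟨h1, h2⟩
      refine ⟨fun _ => -y 0, ⟨by linarith, by linarith⟩, ?_⟩
      funext i
      obtain rfl : i = 0 := Fin.fin_one_eq_zero i
      ring
    · rintro ⟨x, ⟨h1, h2⟩, rfl⟩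
      constructor <;> linarith
  · rw [hi hx]
    show d / (1 + x 0 ^ 2) = d / (1 + (-1 * x 0 + 0) ^ 2) * |(-1:ℝ)|
    rw [abs_neg, abs_one, mul_one]
    ring

/-! ## Additivity in the constant inside the budget -/

/-- `T(t, d + d') − T(t, d) − T(t, d') ∈ relationsLE 1` (inside the budget `relationsLE 1`).
[cite: KontsevichZagier2001, §1.2 rule (1)] -/
theorem ang_add_const_mem_relationsLE {RG : ℝ → ℝ → IntegralRep 1}
    (hRG : ∀ t d, IsAlgebraic ℚ t → IsAlgebraic ℚ d →
      (RG t d).domain = {x | x 0 ∈ Set.Ioo 0 t} ∧ (RG t d).integrand = fun x => d / (1 + x 0 ^ 2))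
    {t d d' : ℝ} (ht : IsAlgebraic ℚ t) (hd : IsAlgebraic ℚ d) (hd' : IsAlgebraic ℚ d') :
    of (RG t (d + d')) - of (RG t d) - of (RG t d') ∈ relationsLE 1 := by
  refine merge_mem_relationsLE (σ := {x | x 0 ∈ Set.Ioo (0:ℝ) t})
    (f₁ := fun x => d / (1 + x 0 ^ 2)) (f₂ := fun x => d' / (1 + x 0 ^ 2)) _ _ _
    (hRG t _ ht (hd.add hd')).1 (hRG t d ht hd).1 (hRG t d' ht hd').1 ?_
    (by rw [(hRG t d ht hd).2]; exact fun _ _ => rfl)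
    (by rw [(hRG t d' ht hd').2]; exact fun _ _ => rfl)
  rw [(hRG t _ ht (hd.add hd')).2]
  intro x _
  show (d + d') / (1 + x 0 ^ 2) = d / (1 + x 0 ^ 2) + d' / (1 + x 0 ^ 2)
  rw [add_div]

/-- `T(t, 0) ∈ relationsLE 1` (inside the budget `relationsLE 1`).
[cite: KontsevichZagier2001, §1.2 rule (1)] -/
theorem ang_zero_mem_relationsLE {RG : ℝ → ℝ → IntegralRep 1}
    (hRG : ∀ t d, IsAlgebraic ℚ t → IsAlgebraic ℚ d →
      (RG t d).domain = {x | x 0 ∈ Set.Ioo 0 t} ∧ (RG t d).integrand = fun x => d / (1 + x 0 ^ 2))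
    {t : ℝ} (ht : IsAlgebraic ℚ t) : of (RG t 0) ∈ relationsLE 1 :=
  angA_zero_mem_relationsLE _ (by rw [(hRG t 0 ht isAlgebraic_zero).2]; exact fun _ _ => rfl)

/-- Additivity in the quotient `FormalRep ⧸ relationsLE 1` (inside the budget `relationsLE 1`).
[cite: KontsevichZagier2001, §1.2 rule (1)] -/
theorem ang_add_const_eq {RG : ℝ → ℝ → IntegralRep 1}
    (hRG : ∀ t d, IsAlgebraic ℚ t → IsAlgebraic ℚ d →
      (RG t d).domain = {x | x 0 ∈ Set.Ioo 0 t} ∧ (RG t d).integrand = fun x => d / (1 + x 0 ^ 2))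
    {t d d' : ℝ} (ht : IsAlgebraic ℚ t) (hd : IsAlgebraic ℚ d) (hd' : IsAlgebraic ℚ d') :
    QuotientAddGroup.mk' (relationsLE 1) (of (RG t (d + d'))) =
      QuotientAddGroup.mk' (relationsLE 1) (of (RG t d)) +
        QuotientAddGroup.mk' (relationsLE 1) (of (RG t d')) := by
  have h := ang_add_const_mem_relationsLE hRG ht hd hd'
  rw [← QuotientAddGroup.eq_zero_iff] at h
  change QuotientAddGroup.mk' (relationsLE 1) _ = 0 at h
  rwa [map_sub, map_sub, sub_sub, sub_eq_zero] at h

/-- Negation in the quotient `FormalRep ⧸ relationsLE 1` (inside the budget `relationsLE 1`).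
[cite: KontsevichZagier2001, §1.2 rule (1)] -/
theorem ang_neg_eq {RG : ℝ → ℝ → IntegralRep 1}
    (hRG : ∀ t d, IsAlgebraic ℚ t → IsAlgebraic ℚ d →
      (RG t d).domain = {x | x 0 ∈ Set.Ioo 0 t} ∧ (RG t d).integrand = fun x => d / (1 + x 0 ^ 2))
    {t d : ℝ} (ht : IsAlgebraic ℚ t) (hd : IsAlgebraic ℚ d) :
    QuotientAddGroup.mk' (relationsLE 1) (of (RG t (-d))) =
      -QuotientAddGroup.mk' (relationsLE 1) (of (RG t d)) := by
  have h := ang_add_const_eq hRG ht hd hd.neg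
  have h0 : QuotientAddGroup.mk' (relationsLE 1) (of (RG t 0)) = 0 :=
    (QuotientAddGroup.eq_zero_iff _).mpr (ang_zero_mem_relationsLE hRG ht)
  rw [add_neg_cancel, h0] at h
  exact (neg_eq_of_add_eq_zero_right h.symm).symm

/-- Integer multiples: `z • T(t, d) = T(t, z d)` in `FormalRep ⧸ relationsLE 1`
(inside the budget `relationsLE 1`). [cite: KontsevichZagier2001, §1.2 rule (1)] -/
theorem ang_zsmul_eq {RG : ℝ → ℝ → IntegralRep 1}
    (hRG : ∀ t d, IsAlgebraic ℚ t → IsAlgebraic ℚ d →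
      (RG t d).domain = {x | x 0 ∈ Set.Ioo 0 t} ∧ (RG t d).integrand = fun x => d / (1 + x 0 ^ 2))
    {t d : ℝ} (ht : IsAlgebraic ℚ t) (hd : IsAlgebraic ℚ d) (z : ℤ) :
    z • QuotientAddGroup.mk' (relationsLE 1) (of (RG t d)) =
      QuotientAddGroup.mk' (relationsLE 1) (of (RG t ((z:ℝ) * d))) := by
  have hnat : ∀ n : ℕ, n • QuotientAddGroup.mk' (relationsLE 1) (of (RG t d)) =
      QuotientAddGroup.mk' (relationsLE 1) (of (RG t ((n:ℝ) * d))) := by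
    intro n
    induction n with
    | zero =>
      rw [zero_smul, Nat.cast_zero, zero_mul]
      exact ((QuotientAddGroup.eq_zero_iff _).mpr (ang_zero_mem_relationsLE hRG ht)).symm
    | succ n ih =>
      rw [add_smul, one_smul, ih, Nat.cast_succ, add_mul, one_mul,
        ang_add_const_eq hRG ht ((isAlgebraic_nat (R := ℚ) n).mul hd) hd]
  cases z with
  | ofNat n => rw [Int.ofNat_eq_natCast, natCast_zsmul, hnat n, Int.cast_natCast]
  | negSucc n =>
    rw [negSucc_zsmul, hnat (n + 1), Int.cast_negSucc, neg_mul,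
      ang_neg_eq hRG ht ((isAlgebraic_nat (R := ℚ) (n + 1)).mul hd)]

/-- Finite sums in the constant, in `FormalRep ⧸ relationsLE 1` (inside the budget `relationsLE 1`).
[cite: KontsevichZagier2001, §1.2 rule (1)] -/
theorem ang_sum_eq {RG : ℝ → ℝ → IntegralRep 1} {ι : Type*} (s : Finset ι) (f : ι → ℝ)
    (hRG : ∀ t d, IsAlgebraic ℚ t → IsAlgebraic ℚ d →
      (RG t d).domain = {x | x 0 ∈ Set.Ioo 0 t} ∧ (RG t d).integrand = fun x => d / (1 + x 0 ^ 2))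
    {t : ℝ} (ht : IsAlgebraic ℚ t) (hf : ∀ i ∈ s, IsAlgebraic ℚ (f i)) :
    QuotientAddGroup.mk' (relationsLE 1) (of (RG t (∑ i ∈ s, f i))) =
      ∑ i ∈ s, QuotientAddGroup.mk' (relationsLE 1) (of (RG t (f i))) := by
  classical
  induction s using Finset.induction_on with
  | empty =>
    rw [Finset.sum_empty, Finset.sum_empty]
    exact (QuotientAddGroup.eq_zero_iff _).mpr (ang_zero_mem_relationsLE hRG ht)
  | insert i s hi ih =>
    rw [Finset.sum_insert hi, Finset.sum_insert hi,
      ang_add_const_eq hRG ht (hf i (Finset.mem_insert_self i s))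
        (Finset.sum_induction _ (IsAlgebraic ℚ) (fun _ _ ha hb => ha.add hb) isAlgebraic_zero
          fun j hj => hf j (Finset.mem_insert_of_mem hj)),
      ih fun j hj => hf j (Finset.mem_insert_of_mem hj)]

/-! ## Intervals on carriers inside the budget -/

/-- **An arctangent interval is a sum of two carriers** (inside the budget `relationsLE 1`;
registered sub-goal of crux stmt-KontsevichZagierPeriods-12475, port of
`PiBox.Dlog.ang_interval_eq`): for real algebraic `a ≤ b` and `d`,
`[(a,b), d/(1+y²)] = T(t₁, d₁) + T(t₂, d₂)` modulo `relationsLE 1` with algebraic `t₁, t₂ ≥ 0` and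
`d₁, d₂ ∈ {d, −d}` (split at `0`, rule 1a, and reflect the negative part, rule 2, in dimension
`1`). [cite: KontsevichZagier2001, §1.2 rules (1), (2)] -/
theorem ang_interval_eq : ∀ {RG : ℝ → ℝ → KZ.IntegralRep 1},
    (∀ t d, IsAlgebraic ℚ t → IsAlgebraic ℚ d →
      (RG t d).domain = {x | x 0 ∈ Set.Ioo 0 t} ∧ (RG t d).integrand = fun x => d / (1 + x 0 ^ 2)) →
    ∀ {a b d : ℝ}, IsAlgebraic ℚ a → IsAlgebraic ℚ b → IsAlgebraic ℚ d → a ≤ b →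
    ∀ (L : KZ.IntegralRep 1), L.domain = {x | x 0 ∈ Set.Ioo a b} →
    Set.EqOn L.integrand (fun x => d / (1 + x 0 ^ 2)) L.domain →
    ∃ t₁ t₂ d₁ d₂ : ℝ, 0 ≤ t₁ ∧ 0 ≤ t₂ ∧ IsAlgebraic ℚ t₁ ∧ IsAlgebraic ℚ t₂ ∧
      IsAlgebraic ℚ d₁ ∧ IsAlgebraic ℚ d₂ ∧
      QuotientAddGroup.mk' (KZ.relationsLE 1) (KZ.of L) =
        QuotientAddGroup.mk' (KZ.relationsLE 1) (KZ.of (RG t₁ d₁)) +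
          QuotientAddGroup.mk' (KZ.relationsLE 1) (KZ.of (RG t₂ d₂)) := by
  intro RG hRG a b d ha hb hd hab L hdL hi
  -- helper: the non-negative case `0 ≤ a ≤ b`: `[L] = T(b, d) − T(a, d)`
  have key : ∀ {a' b' : ℝ}, IsAlgebraic ℚ a' → IsAlgebraic ℚ b' → 0 ≤ a' → a' ≤ b' →
      ∀ (L' : IntegralRep 1), L'.domain = {x | x 0 ∈ Set.Ioo a' b'} →
      EqOn L'.integrand (fun x => d / (1 + x 0 ^ 2)) L'.domain →
      QuotientAddGroup.mk' (relationsLE 1) (of L') =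
        QuotientAddGroup.mk' (relationsLE 1) (of (RG b' d)) +
          QuotientAddGroup.mk' (relationsLE 1) (of (RG a' (-d))) := by
    intro a' b' ha' hb' ha0 hab' L' hdL' hi'
    have h1 := hRG b' d hb' hd
    have h2 := hRG a' d ha' hd
    have hsplit : of (RG b' d) - of (RG a' d) - of L' ∈ relationsLE 1 :=
      split_mem_relationsLE _ _ _ h1.1 h2.1 hdL' ha0 hab' (by rw [h2.2, h1.2]; exact fun _ _ => rfl)
        (by rw [h1.2]; exact hi')
    rw [← QuotientAddGroup.eq_zero_iff] at hsplit
    change QuotientAddGroup.mk' (relationsLE 1) _ = 0 at hsplit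
    rw [map_sub, map_sub, sub_eq_zero] at hsplit
    rw [← hsplit, ang_neg_eq hRG ha' hd]
    abel
  by_cases ha0 : 0 ≤ a
  · exact ⟨b, a, d, -d, ha0.trans hab, ha0, hb, ha, hd, hd.neg, key ha hb ha0 hab L hdL hi⟩
  · have ha0' : a < 0 := not_le.mp ha0
    by_cases hb0 : b ≤ 0
    · -- reflect `(a,b)` onto `(−b,−a)` with `0 ≤ −b ≤ −a`
      obtain ⟨L', hdL', hiL'⟩ := exists_angA hb.neg ha.neg hd
      have hrefl : of L - of L' ∈ relationsLE 1 := angA_reflect_mem_relationsLE L L' hdL hdL' hi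
        (by rw [hiL']; exact fun _ _ => rfl)
      rw [← QuotientAddGroup.eq_zero_iff] at hrefl
      change QuotientAddGroup.mk' (relationsLE 1) _ = 0 at hrefl
      rw [map_sub, sub_eq_zero] at hrefl
      refine ⟨-a, -b, d, -d, by linarith, by linarith, ha.neg, hb.neg, hd, hd.neg, ?_⟩
      rw [hrefl]
      exact key hb.neg ha.neg (by linarith) (by linarith) L' hdL' (by rw [hiL']; exact fun _ _ => rfl)
    · have hb0' : 0 < b := not_le.mp hb0
      -- split at `0`: `(a,0)` reflected onto `(0,−a)`, and `(0,b)`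
      obtain ⟨L₁, hdL₁, hiL₁⟩ := exists_angA ha isAlgebraic_zero hd
      have h2 := hRG b d hb hd
      have hsplit : of L - of L₁ - of (RG b d) ∈ relationsLE 1 := by
        refine split_mem_relationsLE _ _ _ hdL hdL₁ h2.1 ha0'.le hb0'.le ?_ ?_
        · intro x hx
          rw [hiL₁]
          have hx' : x ∈ L.domain := by
            rw [hdL]; rw [hdL₁] at hx; exact ⟨hx.1, lt_trans hx.2 hb0'⟩
          exact (hi hx').symm
        · intro x hx
          rw [h2.2]
          have hx' : x ∈ L.domain := by
            rw [hdL]; rw [h2.1] at hx; exact ⟨lt_trans ha0' hx.1, hx.2⟩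
          exact (hi hx').symm
      have h3 := hRG (-a) d ha.neg hd
      have hrefl : of L₁ - of (RG (-a) d) ∈ relationsLE 1 :=
        angA_reflect_mem_relationsLE L₁ (RG (-a) d) hdL₁ (by rw [h3.1, neg_zero])
          (by rw [hiL₁]; exact fun _ _ => rfl) (by rw [h3.2]; exact fun _ _ => rfl)
      rw [← QuotientAddGroup.eq_zero_iff] at hsplit hrefl
      change QuotientAddGroup.mk' (relationsLE 1) _ = 0 at hsplit hrefl
      rw [map_sub, map_sub, sub_sub, sub_eq_zero] at hsplit
      rw [map_sub, sub_eq_zero] at hrefl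
      refine ⟨-a, b, d, d, by linarith, hb0'.le, ha.neg, hb, hd, hd, ?_⟩
      rw [hsplit, hrefl]

end Dlog

end Summit.KontsevichZagierPeriods.AbelContraction.RealHyperellipticSector.Port

end
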